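import Summits.CriticalPhenomena.PercolationContinuityZ3.Theorems.PercNearOneGluingNoHeavyQuantGatedSliceWindow
import Summits.CriticalPhenomena.PercolationContinuityZ3.Theorems.PercNearOneGluingNoHeavyQuantLawDecFlows
import Summits.CriticalPhenomena.PercolationContinuityZ3.Theorems.PercNearOneGluingNoHeavyQuantLawDecFlowsDecomposition
import HarnessLib

/-!
# QUANT lane R8, T-DEC, leg (III), blob case: `LawDec.GatedSliceMixLaw` IS FALSE AS TYPED — a boundary witness (`θ < 1`),
# and the repaired statement (`θ ≤ 1`) holds at the witness

builds on p205010 (kernel theorem, internal audit signed; external expert review pending)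

Support file (`--supports stmt-CriticalPhenomena-4575`), QUANT lane arm-3 (gen 63, ON-ASK literal-test seat, V278 SECOND-SEAT test of
typer g29's `@[conjecture] LawDec.GatedSliceMixLaw`, `…QuantGatedSliceWindow`; the typer's own refutation `LawDec.not_gatedSliceMixLaw`
(`…QuantGatedSliceMixLawRefutation`, found in parallel) landed first — this file is the independent confirmation with the SMALLEST witness
(`M = 4, a = 1`, three atoms) and the exact characterisation `DEC ↔ θ = 1` at it).  Theorems only, standard axioms, no sorries.

THE WITNESS (W0).  `y = 7/8`, `z = 0`, `g = 1`, `S = 7/2`, `λ = 5/6`, `a = 1`, `j = 4`, `M = 4`, `h = 4`, `μ₂ = {1, 4; 5/6}` (mean `7/2 = S`).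
Every hypothesis of the binder holds (`y·M = S`: top-affordability TIGHT; `y ≤ (1−z)g = 1`; `S < h = M ≤ j < M + a`).  Target
`t = S + ag(1−z) = 9/2`, positions `{0..5}`, layer `j = 4`: lows `0, 1, 2`, mids `3, 4`, giant `5`, giant usage `u = y/(1−y) = 7`.
`W_h = weakMidLaw (7/2) 1 4 1 = {0: 1/8, 5: 7/8}` (the mid atom `h` carries `(S/h)(1−g) = 0`) is DEC with ZERO slack (`7 · 1/8 = 7/8`);
`P[μ₂] = slice μ₂ 1 1 = {2: 1/6, 5: 5/6}` is NOT DEC (`7 · 1/6 > 5/6`; the mids `3, 4` are empty).  For the mixture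
`Q_θ = θ W_h + (1−θ) P[μ₂] = {0: θ/8, 2: (1−θ)/6, 5: 7θ/8 + 5(1−θ)/6}` the price system `α ≡ 7` (lows), `β = 1` (giant), `β = 2` (mids;
legal: `2·usage ≥ 7` on the three compatible low–mid cells `(1,4), (2,3), (2,4)`) has value `7θ/8 + 7(1−θ)/6 − 7θ/8 − 5(1−θ)/6 = (1−θ)/3 > 0`
for every `θ < 1`, so NO `θ ∈ [0, 1)` makes `Q_θ` DEC (weak duality, `dual_le_of_decAtT`): the conclusion of `GatedSliceMixLaw` fails.
At `θ = 1` the mixture IS DEC (`gatedSliceMixLaw_witness_top`): the failure is the BOUNDARY `θ < 1` of the binder, not the mixing claim.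

CLASSIFICATION (refuted-misstated).  The repaired statement C′ = the same binder with `θ ≤ 1` in place of `θ < 1` is what the dual route
needs (in `gatedSlice_weakMid_functional_le` the case `θ = 1` contradicts the weak-mid inequality `⟨e, W_h⟩ > 0` directly) and what the
typer's evidence tested (an LP with `θ` free in the CLOSED interval); the witness misses C′.  The boundary family is
`g = 1, h = k₂ = M, y = S/M` (TA-tight), `k₁ ≥ 1`, `2k₁ + a < S`, `λ < 1`, any `z` with `y ≤ 1 − z`: `W_M = {0: 1−y', M+a: y'}`-type laws
DEC with zero slack while `P[μ₂]`'s shifted low `k₁ + a` overloads the common giant `M + a`.  Arm-3 g63's exact census of C′ itself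
(joint `θ`-LP with optimality certificates; memo `run/shared/lean/prim/quant/prim-quant-arm-3-g63/MIXLAW-LITERAL-TEST-G63.md`) is reported
on the lane INBOX.

* `LawDec.gatedSliceMixLaw_witness_not` — for every `θ < 1` the witness mixture is not DEC at `(7/8, 9/2, 4)` on `{0..5}`.
* `LawDec.not_gatedSliceMixLaw_w0 : ¬ GatedSliceMixLaw` (second, independent kernel refutation; the typer's own `not_gatedSliceMixLaw`
  — found in parallel, `…QuantGatedSliceMixLawRefutation`, witness `M = 9, a = 2` — landed first).
* `LawDec.gatedSliceMixLaw_witness_dec_iff` — at the witness the binder's mixture is DEC iff `θ = 1`.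
* `LawDec.gatedSliceMixLaw_witness_top` — `W_h` itself (the mixture at `θ = 1`) IS DEC there (the repaired statement holds at the witness).

[this work]; the conjecture and `weakMidLaw`: typer g29 (`…QuantGatedSliceWindow`); weak duality `dual_le_of_decAtT`, `decAtT_iff_flowAtT`:
this lane (`…QuantLawDecFlows`, `…FlowsDecomposition`).  The gluing rows served [cite: KozmaNitzan2024, Conjecture 3 (p. 15)]; product
measure [cite: Grimmett1999, §1.3 p. 10].
-/

noncomputable section

namespace Summit.CriticalPhenomena.PercolationContinuityZ3.Theorems

namespace Quant

open Finset

/-- the two-point law `{lo, hi; g}` (as in `…QuantLawDEC`) -/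
local notation3 "TP[" lo ", " hi ", " g ", " h "]" =>
  (g : ℝ) * (if (h : ℕ) = (hi : ℕ) then (1 : ℝ) else 0) + (1 - (g : ℝ)) * (if (h : ℕ) = (lo : ℕ) then (1 : ℝ) else 0)

namespace LawDec

/-- usage of a low atom at a GIANT absorber `h ≥ j′+1` is `x/(1−x)`. -/
private theorem usage_giant_w0 (x T : ℝ) (j' l h : ℕ) (hjh : j' + 1 ≤ h) : usage x T j' l h = x / (1 - x) := by
  simp only [usage, gateOf, if_pos hjh]

/-- usage of a low atom at a MID absorber `h ≤ j′` when the credit gate is the HEAVY branch `x² + (1−x)ρ ≥ ρ`. -/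
private theorem usage_mid_heavy_w0 (x T ρ : ℝ) (j' l h : ℕ) (hjh : ¬ j' + 1 ≤ h) (hρ : (T - 2 * (l : ℝ)) / ((h : ℝ) - l) = ρ)
    (hle : ρ ≤ x ^ 2 + (1 - x) * ρ) :
    usage x T j' l h = (x ^ 2 + (1 - x) * ρ) / (1 - (x ^ 2 + (1 - x) * ρ)) := by
  simp only [usage, gateOf, if_neg hjh, pairGate, hρ, max_eq_right hle]

/-- **the price system of the witness is legal**: `α ≡ 7` on the lows, `β = 1` on the giant `5`, `β = 2` on the mids, at `(7/8, 9/2, 4)`,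
top `5`. [this work] -/
private theorem prices_w0 (l h : ℕ) (hl : l ≤ 4) (hlow : 2 * (l : ℝ) < 9 / 2) (hh : h ≤ 5)
    (hcomp : 4 + 1 ≤ h ∨ (9 / 2 : ℝ) < (l : ℝ) + h) :
    (7 : ℝ) ≤ usage (7 / 8) (9 / 2) 4 l h * (if 4 + 1 ≤ h then (1 : ℝ) else 2) := by
  by_cases h5 : 4 + 1 ≤ h
  · rw [if_pos h5, usage_giant_w0 (7 / 8) (9 / 2) 4 l h h5]; norm_num
  · rw [if_neg h5]
    have hh4 : h ≤ 4 := by omega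
    rcases hcomp with h5' | hlt
    · exact absurd h5' h5
    · have hl2 : l ≤ 2 := by
        by_contra hc
        have h3 : (3 : ℝ) ≤ (l : ℝ) := by exact_mod_cast (show 3 ≤ l by omega)
        linarith
      interval_cases l <;> interval_cases h <;> norm_num at hlt
      · rw [usage_mid_heavy_w0 (7 / 8) (9 / 2) (5 / 6) 4 1 4 (by norm_num) (by norm_num) (by norm_num)]; norm_num
      · rw [usage_mid_heavy_w0 (7 / 8) (9 / 2) (1 / 2) 4 2 3 (by norm_num) (by norm_num) (by norm_num)]; norm_num
      · rw [usage_mid_heavy_w0 (7 / 8) (9 / 2) (1 / 4) 4 2 4 (by norm_num) (by norm_num) (by norm_num)]; norm_num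

/-- **CONCLUSION of the witness fails for every `θ < 1`**: the mixture `θ·W_h + (1−θ)·P[μ₂]` of the binder at
`(S, g, h, a) = (7/2, 1, 4, 1)`, `z = 0`, `μ₂ = {1, 4; 5/6}` — the law `{0: θ/8, 2: (1−θ)/6, 5: 7θ/8 + 5(1−θ)/6}` — is NOT DEC at
`(7/8, 9/2, 4)` on `{0..5}` (weak duality with the prices of `prices_w0`: value `(1−θ)/3 > 0`). [this work] -/
theorem gatedSliceMixLaw_witness_not (θ : ℝ) (hθ1 : θ < 1) :
    ¬ DECAtT (7 / 8) (9 / 2) 4 5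
      (fun p => θ * weakMidLaw (7 / 2) 1 4 1 p
        + (1 - θ) * (0 * (if p = 0 then (1 : ℝ) else 0) + (1 - 0) * slice (fun q => TP[1, 4, (5 / 6 : ℝ), q]) 1 1 p)) := by
  intro hdec
  have wd := dual_le_of_decAtT (7 / 8) (9 / 2) 4 5 _ (by norm_num) (by norm_num) hdec (fun _ => 7)
    (fun h => if 4 + 1 ≤ h then (1 : ℝ) else 2) (fun h => by split_ifs <;> norm_num) prices_w0
  simp only [Finset.sum_range_succ, Finset.sum_range_zero, weakMidLaw, slice] at wd
  norm_num at wd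
  linarith

/-- **The repaired statement holds at the witness**: `W_h = weakMidLaw (7/2) 1 4 1 = {0: 1/8, 5: 7/8}` (the mixture at `θ = 1`) IS DEC at
`(7/8, 9/2, 4)` on `{0..5}` — flow `0 → 5: 1/8` at the giant usage `7`, load `7/8` = the giant's mass exactly (zero slack). [this work] -/
theorem gatedSliceMixLaw_witness_top : DECAtT (7 / 8) (9 / 2) 4 5 (weakMidLaw (7 / 2) 1 4 1) := by
  have l_top : ∀ p, 5 < p → weakMidLaw (7 / 2) 1 4 1 p = 0 := fun p hp => weakMidLaw_eq_zero (7 / 2) 1 4 1 p (by omega)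
  have l_mass : ∑ p ∈ Finset.range (5 + 1), weakMidLaw (7 / 2) 1 4 1 p = 1 := sum_weakMidLaw (7 / 2) 1 4 1 5 (by norm_num)
  rw [decAtT_iff_flowAtT _ _ 4 5 _ (by norm_num) (by norm_num) l_top l_mass]
  have ug : ∀ l h, 4 + 1 ≤ h → usage (7 / 8 : ℝ) (9 / 2) 4 l h = 7 := by
    intro l h hh; rw [usage_giant_w0 (7 / 8) (9 / 2) 4 l h hh]; norm_num
  refine ⟨fun l h => if h = 5 then (if l = 0 then 1 / 8 else 0) else 0, ?_, ?_, ?_, ?_⟩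
  · intro l h
    dsimp only
    split_ifs <;> norm_num
  · intro l h hlh
    dsimp only at hlh
    split_ifs at hlh with h1 h2
    · subst h1; subst h2; norm_num
    · exact absurd hlh (lt_irrefl 0)
    · exact absurd hlh (lt_irrefl 0)
  · intro l hl hlow
    have hl2 : l ≤ 2 := by
      by_contra hc
      have h3 : (3 : ℝ) ≤ (l : ℝ) := by exact_mod_cast (show 3 ≤ l by omega)
      linarith
    interval_cases l <;> simp only [Finset.sum_range_succ, Finset.sum_range_zero, weakMidLaw] <;> norm_num
  · intro h hh habs
    interval_cases h <;> simp only [Finset.sum_range_succ, Finset.sum_range_zero, weakMidLaw] <;> norm_num [ug]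

/-- **At the witness the binder's mixture is DEC iff `θ = 1`** (`θ ≤ 1`): the `θ < 1` side is `gatedSliceMixLaw_witness_not`, the
`θ = 1` side is `gatedSliceMixLaw_witness_top` — so the REPAIRED statement (`θ ≤ 1`) holds at the witness while the typed one fails. [this work] -/
theorem gatedSliceMixLaw_witness_dec_iff (θ : ℝ) (hθ1 : θ ≤ 1) :
    DECAtT (7 / 8) (9 / 2) 4 5
      (fun p => θ * weakMidLaw (7 / 2) 1 4 1 p
        + (1 - θ) * (0 * (if p = 0 then (1 : ℝ) else 0) + (1 - 0) * slice (fun q => TP[1, 4, (5 / 6 : ℝ), q]) 1 1 p))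
      ↔ θ = 1 := by
  constructor
  · intro h
    by_contra hne
    exact gatedSliceMixLaw_witness_not θ (lt_of_le_of_ne hθ1 hne) h
  · rintro rfl
    convert gatedSliceMixLaw_witness_top using 2 with p
    ring

/-- **`LawDec.GatedSliceMixLaw` IS FALSE AS TYPED (arm-3 g63, V278 second-seat literal test).**  The instance `y = 7/8`, `z = 0`, `g = 1`,
`S = 7/2`, `λ = 5/6`, `a = 1`, `j = 4`, `M = 4`, `h = 4`, `k₁ = 1`, `k₂ = 4` satisfies every hypothesis of the binder (top-affordability
`y·M = S` tight) and admits no `θ ∈ [0, 1)`: at the witness the mixture is DEC iff `θ = 1` (`gatedSliceMixLaw_witness_dec_iff`), so the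
repaired statement with `θ ≤ 1` holds here while the typed one fails.  builds on p205010 (kernel theorem, internal audit signed; external expert review pending). [this work] -/
theorem not_gatedSliceMixLaw_w0 : ¬ GatedSliceMixLaw := by
  intro H
  obtain ⟨θ, _, hθ1, hdec⟩ := H (7 / 8) 0 1 (7 / 2) (5 / 6) 1 4 4 4 1 4 (by norm_num) (by norm_num) le_rfl (by norm_num) le_rfl
    (by norm_num) le_rfl (by norm_num) (by norm_num) (by norm_num) le_rfl le_rfl (by norm_num) (by norm_num) le_rfl (by norm_num)
    (by norm_num) (by norm_num)
  have ht : (7 / 2 : ℝ) + ((1 : ℕ) : ℝ) * 1 * (1 - 0) = 9 / 2 := by norm_num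
  rw [ht] at hdec
  have h1 := (gatedSliceMixLaw_witness_dec_iff θ hθ1.le).1 hdec
  linarith

end LawDec

end Quant

end Summit.CriticalPhenomena.PercolationContinuityZ3.Theorems
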